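import Summits.QuantumFields.YangMills.Theorems.LuscherReductionTwistedTraceScalingBTColourFPReduction
import HarnessLib

/-!
# (B-T) from a pointwise kernel comparison with a RELATIVE error on the window and an ABSOLUTE tail — the LOCALITY door
# (lane A of S-BASE, crux `TwistedTraceScaling` stmt-QuantumFields-20203, C4-CORE, the (B-T) pen; design note `pub/ym-fleet/ym-luscher-20007-p1/COARSE-DESIGN.md` §25.6)

`…BTPointwise` / `…BTColourFPReduction` reduce (B-T) to the RELATIVE pointwise bound `|𝒦 − cK̃₁| ≤ κcK̃₁` on the whole window `{orbitDist₁ < δ₁}²`.  For slow pairs `(u,u')`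
far apart on the scale `(L³β)^{-1/2}log β` both kernels are super-polynomially small and a relative comparison is neither available nor needed: this file admits an
ABSOLUTE tail `τ`.  Since `∫∫τ|φ(u)||φ(u')| = τ(∫|φ|)² ≤ τ‖φ‖²` and the slack of (B-T) is `κσγ·λ₀(1,B)‖φ‖²`, a tail `τ ≤ κ₂·c·λ₀(1,B)` costs `κ ↦ κ + κ₂`:
* `sq_integral_abs_le_integral_sq_of_bounded` — `(∫|φ|)² ≤ ∫φ²` for bounded measurable `φ` (probability space);
* ★★ `tubeForm_boFun_near_of_pointwise_add` — `|𝒦 − cK̃₁| ≤ κcK̃₁ + τ` on the window ⇒ `|T(boFun φ Ω) − c⟨φ,K_Bφ⟩| ≤ κc(⟨φ,K_Bφ⟩ + λ₀‖φ‖²) + τ‖φ‖²`;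
* ★★ `boKernel_pointwise_of_fp_add` — `|fpBOKernel − CK₁| ≤ κCK₁ + τ` ⇒ `|𝒦 − (C/Z)K̃₁| ≤ κ(C/Z)K̃₁ + τ/Z`;
* ★★★ `hT_of_fp_add` — the `∀ᶠ β` packaging into `RecordAnalyticInput.hT` with `σ β := C β/Z β/γ β` and rate `κ β + κ₂ β` when `τ β / Z β ≤ κ₂ β·(C β/Z β)·λ₀(1, L³β)`.
So the Laplace core of (B-T) may be proved as: RELATIVE `1 ± κ` for `max_k |(u_k u'_k⁻¹)⃗| ≤ (L³β)^{-1/2}log β`, ABSOLUTE `≤ τ` beyond (§25.6 (L1)–(L4)).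
HONEST FRAMING: bookkeeping; the Laplace core of (B-T) is OPEN; C4-CORE OPEN; stub of a child of the CONDITIONAL route R2b1; not infinite volume, not a gap, not Clay.
-/

set_option autoImplicit false

noncomputable section

open MeasureTheory Filter Topology Real
open scoped BigOperators
open Literature.MathematicalPhysics.QuantumFieldTheory
open Literature.MathematicalPhysics.QuantumLattice

namespace Summit.QuantumFields.YangMills.Theorems.FemtoTransferGap.TwoLattice.ConstTube

open Summit.QuantumFields.YangMills.Theorems.FemtoTransferGap
open Summit.QuantumFields.YangMills.Theorems.FemtoTransferGap.TwoLattice.Avg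
open Summit.QuantumFields.YangMills.Theorems.FemtoTransferGap.TwoLattice.Stiff (LinkSpace)

variable {L : ℕ} [NeZero L]

/-! ## §1 Jensen on the one-site probability space -/

/-- `(∫|φ|)² ≤ ∫φ²` for bounded measurable `φ` on the configuration probability space. [folklore] -/
theorem sq_integral_abs_le_integral_sq_of_bounded {M : ℕ} [NeZero M] {φ : GaugeConfig 3 M SU2 → ℝ} (hφm : Measurable φ) {C : ℝ} (hC : ∀ u, |φ u| ≤ C) :
    (∫ u, |φ u| ∂configMeasure SU2 M) ^ 2 ≤ ∫ u, φ u ^ 2 ∂configMeasure SU2 M := by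
  have hi1 : Integrable (fun u => |φ u|) (configMeasure SU2 M) :=
    integrable_of_measurable_abs_le _ hφm.abs (C := C) fun u => by rw [abs_abs]; exact hC u
  have hi2 : Integrable (fun u => φ u ^ 2) (configMeasure SU2 M) :=
    integrable_of_measurable_abs_le _ (hφm.pow_const 2) (C := C ^ 2) fun u => by rw [abs_pow]; exact pow_le_pow_left₀ (abs_nonneg _) (hC u) 2
  set m : ℝ := ∫ u, |φ u| ∂configMeasure SU2 M with hm
  have h0 : 0 ≤ ∫ u, (|φ u| - m) ^ 2 ∂configMeasure SU2 M := integral_nonneg fun u => sq_nonneg _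
  have hpt : (fun u : GaugeConfig 3 M SU2 => (|φ u| - m) ^ 2) = fun u => φ u ^ 2 - 2 * m * |φ u| + m ^ 2 := by
    funext u; rw [sub_sq, sq_abs]; ring
  have h1 : ∫ u, (|φ u| - m) ^ 2 ∂configMeasure SU2 M = (∫ u, φ u ^ 2 ∂configMeasure SU2 M) - 2 * m * m + m ^ 2 := by
    rw [hpt]
    have hi3 : Integrable (fun u => 2 * m * |φ u|) (configMeasure SU2 M) := hi1.const_mul (2 * m)
    have e1 : ∫ u, φ u ^ 2 - 2 * m * |φ u| + m ^ 2 ∂configMeasure SU2 M =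
        (∫ u, (φ u ^ 2 - 2 * m * |φ u|) ∂configMeasure SU2 M) + ∫ _u, m ^ 2 ∂configMeasure SU2 M := integral_add (hi2.sub hi3) (integrable_const _)
    have e2 : ∫ u, (φ u ^ 2 - 2 * m * |φ u|) ∂configMeasure SU2 M = (∫ u, φ u ^ 2 ∂configMeasure SU2 M) - ∫ u, 2 * m * |φ u| ∂configMeasure SU2 M :=
      integral_sub hi2 hi3
    have e3 : ∫ u, 2 * m * |φ u| ∂configMeasure SU2 M = 2 * m * m := by rw [integral_const_mul, hm]
    have e4 : ∫ _u : GaugeConfig 3 M SU2, m ^ 2 ∂configMeasure SU2 M = m ^ 2 := by simp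
    rw [e1, e2, e3, e4]
  nlinarith [h0, h1]

/-! ## §2 ★★ (B-T) at one `β` from a relative-plus-absolute pointwise comparison -/

/-- ★★ If `|𝒦_β(u,u') − c·K̃₁^{(B)}(u,u')| ≤ κ·c·K̃₁^{(B)}(u,u') + τ` on the window `{orbitDist < δ}` (`B ≥ 0`, `c, κ, τ ≥ 0`, `δ < 2`), then for every gauge-invariant bounded measurable
`φ` supported there `|T(boFun φ Ω) − c·⟨φ, K_B φ⟩| ≤ κ·c·(⟨φ, K_B φ⟩ + λ₀(1,B)‖φ‖²) + τ‖φ‖²`. [cite: Luscher1983, §3] -/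
theorem tubeForm_boFun_near_of_pointwise_add (β : ℝ) {B : ℝ} (hB : 0 ≤ B) {Ω : LinkSpace L → ℝ} (hΩ : Measurable Ω) {CΩ : ℝ} (hCΩ : ∀ x, |Ω x| ≤ CΩ)
    {c κ τ δ : ℝ} (hc : 0 ≤ c) (hκ : 0 ≤ κ) (hτ : 0 ≤ τ) (hδ : δ < 2)
    (hpt : ∀ u u' : GaugeConfig 3 1 SU2, orbitDist u < δ → orbitDist u' < δ →
      |boKernel L β Ω u u' - c * avgKernel B u u'| ≤ κ * c * avgKernel B u u' + τ)
    {φ : GaugeConfig 3 1 SU2 → ℝ} (hφm : Measurable φ) {Cφ : ℝ} (hCφ : ∀ u, |φ u| ≤ Cφ)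
    (hφg : ∀ (g : Site 3 1 → SU2) (u : GaugeConfig 3 1 SU2), φ (gaugeTransform g u) = φ u) (hsupp : ∀ u, φ u ≠ 0 → orbitDist u < δ) :
    |tubeForm β (boFun L φ Ω) - c * qform su2Rep B φ φ| ≤ κ * c * (qform su2Rep B φ φ + levelValue su2Rep 1 B 0 * l2 φ φ) + τ * l2 φ φ := by
  have hCφ0 : 0 ≤ Cφ := (abs_nonneg _).trans (hCφ 1)
  obtain ⟨MB, hMB0, hMB⟩ := exists_avgKernel_le (L := 1) B
  obtain ⟨KB, hKB0, hKB⟩ := abs_boKernel_le (L := L) β hCΩ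
  set A : GaugeConfig 3 1 SU2 → ℝ := fun u => ∫ u', boKernel L β Ω u u' * φ u' ∂configMeasure SU2 1 with hA
  set R : GaugeConfig 3 1 SU2 → ℝ := fun u => ∫ u', avgKernel B u u' * φ u' ∂configMeasure SU2 1 with hR
  set Rabs : GaugeConfig 3 1 SU2 → ℝ := fun u => ∫ u', avgKernel B u u' * |φ u'| ∂configMeasure SU2 1 with hRabs
  set m : ℝ := ∫ u', |φ u'| ∂configMeasure SU2 1 with hm
  have hT : tubeForm β (boFun L φ Ω) = ∫ u, φ u * A u ∂configMeasure SU2 1 := tubeForm_boFun_eq β hφm hCφ hΩ hCΩ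
  have hQ : qform su2Rep B φ φ = ∫ u, φ u * R u ∂configMeasure SU2 1 := qform_eq_integral_avgKernel_of_invariant B hφm hCφ hφg
  have hφam : Measurable fun u => |φ u| := hφm.abs
  have hφaC : ∀ u, |(fun u => |φ u|) u| ≤ Cφ := fun u => by dsimp only; rw [abs_abs]; exact hCφ u
  have hφag : ∀ (g : Site 3 1 → SU2) (u : GaugeConfig 3 1 SU2), (fun u => |φ u|) (gaugeTransform g u) = (fun u => |φ u|) u := fun g u => by
    simp only [hφg]
  have hQabs : qform su2Rep B (fun u => |φ u|) (fun u => |φ u|) = ∫ u, |φ u| * Rabs u ∂configMeasure SU2 1 :=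
    qform_eq_integral_avgKernel_of_invariant B hφam hφaC hφag
  have hiabs : Integrable (fun u' => |φ u'|) (configMeasure SU2 1) := integrable_of_measurable_abs_le _ hφam hφaC
  have hintA : ∀ u, Integrable (fun u' => boKernel L β Ω u u' * φ u') (configMeasure SU2 1) := fun u =>
    integrable_of_measurable_abs_le _ ((measurable_boKernel_right (L := L) β hΩ u).mul hφm) (C := KB * Cφ) fun u' => by
      rw [abs_mul]; exact mul_le_mul (hKB u u') (hCφ u') (abs_nonneg _) hKB0
  have hintR : ∀ u, Integrable (fun u' => avgKernel B u u' * φ u') (configMeasure SU2 1) := fun u =>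
    integrable_of_measurable_abs_le _ ((measurable_avgKernel_right B u).mul hφm) (C := MB * Cφ) fun u' => by
      rw [abs_mul, abs_of_pos (avgKernel_pos B _ _)]; exact mul_le_mul (hMB u u') (hCφ u') (abs_nonneg _) hMB0.le
  have hintRabs : ∀ u, Integrable (fun u' => avgKernel B u u' * |φ u'|) (configMeasure SU2 1) := fun u =>
    integrable_of_measurable_abs_le _ ((measurable_avgKernel_right B u).mul hφam) (C := MB * Cφ) fun u' => by
      rw [abs_mul, abs_of_pos (avgKernel_pos B _ _), abs_abs]; exact mul_le_mul (hMB u u') (hCφ u') (abs_nonneg _) hMB0.le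
  -- the row estimate with tail: `|φ(u)|·|A(u) − cR(u)| ≤ κc|φ(u)|Rabs(u) + τ|φ(u)|·m`
  have hrow : ∀ u, |φ u * A u - c * (φ u * R u)| ≤ κ * c * (|φ u| * Rabs u) + τ * (|φ u| * m) := by
    intro u
    by_cases hu : φ u = 0
    · simp [hu]
    have hud : orbitDist u < δ := hsupp u hu
    have e1 : φ u * A u - c * (φ u * R u) = φ u * ∫ u', (boKernel L β Ω u u' - c * avgKernel B u u') * φ u' ∂configMeasure SU2 1 := by
      rw [hA, hR]; dsimp only
      rw [show (fun u' => (boKernel L β Ω u u' - c * avgKernel B u u') * φ u') = fun u' => boKernel L β Ω u u' * φ u' - c * (avgKernel B u u' * φ u') by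
        funext u'; ring, integral_sub (hintA u) ((hintR u).const_mul c), integral_const_mul]
      ring
    have hI : |∫ u', (boKernel L β Ω u u' - c * avgKernel B u u') * φ u' ∂configMeasure SU2 1| ≤ κ * c * Rabs u + τ * m := by
      calc |∫ u', (boKernel L β Ω u u' - c * avgKernel B u u') * φ u' ∂configMeasure SU2 1|
          ≤ ∫ u', |(boKernel L β Ω u u' - c * avgKernel B u u') * φ u'| ∂configMeasure SU2 1 := abs_integral_le_integral_abs
        _ ≤ ∫ u', (κ * c * (avgKernel B u u' * |φ u'|) + τ * |φ u'|) ∂configMeasure SU2 1 := by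
            refine integral_mono_of_nonneg (ae_of_all _ fun _ => abs_nonneg _) (((hintRabs u).const_mul _).add (hiabs.const_mul _)) (ae_of_all _ fun u' => ?_)
            show |(boKernel L β Ω u u' - c * avgKernel B u u') * φ u'| ≤ κ * c * (avgKernel B u u' * |φ u'|) + τ * |φ u'|
            by_cases hu' : φ u' = 0
            · simp [hu']
            rw [abs_mul]
            have h := hpt u u' hud (hsupp u' hu')
            calc |boKernel L β Ω u u' - c * avgKernel B u u'| * |φ u'| ≤ (κ * c * avgKernel B u u' + τ) * |φ u'| := mul_le_mul_of_nonneg_right h (abs_nonneg _)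
              _ = κ * c * (avgKernel B u u' * |φ u'|) + τ * |φ u'| := by ring
        _ = κ * c * Rabs u + τ * m := by rw [integral_add ((hintRabs u).const_mul _) (hiabs.const_mul _), integral_const_mul, integral_const_mul]
    rw [e1, abs_mul]
    calc |φ u| * |∫ u', (boKernel L β Ω u u' - c * avgKernel B u u') * φ u' ∂configMeasure SU2 1| ≤ |φ u| * (κ * c * Rabs u + τ * m) :=
          mul_le_mul_of_nonneg_left hI (abs_nonneg _)
      _ = κ * c * (|φ u| * Rabs u) + τ * (|φ u| * m) := by ring
  have hintφA : Integrable (fun u => φ u * A u) (configMeasure SU2 1) := by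
    have hAm : Measurable A := by
      have hF : Measurable fun p : GaugeConfig 3 1 SU2 × GaugeConfig 3 1 SU2 => boKernel L β Ω p.1 p.2 * φ p.2 :=
        (measurable_boKernel (L := L) β hΩ).mul (hφm.comp measurable_snd)
      have h := (hF.stronglyMeasurable.integral_prod_right' (ν := configMeasure SU2 1)).measurable
      rw [hA]; simpa only using h
    refine integrable_of_measurable_abs_le _ (hφm.mul hAm) (C := Cφ * (KB * Cφ)) fun u => ?_
    rw [abs_mul]
    refine mul_le_mul (hCφ u) ?_ (abs_nonneg _) hCφ0
    calc |A u| ≤ ∫ u', |boKernel L β Ω u u' * φ u'| ∂configMeasure SU2 1 := abs_integral_le_integral_abs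
      _ ≤ ∫ _u', KB * Cφ ∂configMeasure SU2 1 :=
          integral_mono_of_nonneg (ae_of_all _ fun _ => abs_nonneg _) (integrable_const _) (ae_of_all _ fun u' => by
            show |boKernel L β Ω u u' * φ u'| ≤ KB * Cφ
            rw [abs_mul]; exact mul_le_mul (hKB u u') (hCφ u') (abs_nonneg _) hKB0)
      _ = KB * Cφ := by simp
  have hintφR : Integrable (fun u => φ u * R u) (configMeasure SU2 1) := integrable_mul_integral_avgKernel B hφm hCφ hφm hCφ
  have hintφRabs : Integrable (fun u => |φ u| * Rabs u) (configMeasure SU2 1) := integrable_mul_integral_avgKernel B hφam hφaC hφam hφaC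
  have hdiff : tubeForm β (boFun L φ Ω) - c * qform su2Rep B φ φ = ∫ u, (φ u * A u - c * (φ u * R u)) ∂configMeasure SU2 1 := by
    rw [hT, hQ, ← integral_const_mul, ← integral_sub hintφA (hintφR.const_mul c)]
  have habs : |tubeForm β (boFun L φ Ω) - c * qform su2Rep B φ φ| ≤ κ * c * qform su2Rep B (fun u => |φ u|) (fun u => |φ u|) + τ * m ^ 2 := by
    rw [hdiff, hQabs]
    calc |∫ u, (φ u * A u - c * (φ u * R u)) ∂configMeasure SU2 1| ≤ ∫ u, |φ u * A u - c * (φ u * R u)| ∂configMeasure SU2 1 := abs_integral_le_integral_abs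
      _ ≤ ∫ u, (κ * c * (|φ u| * Rabs u) + τ * (|φ u| * m)) ∂configMeasure SU2 1 :=
          integral_mono_of_nonneg (ae_of_all _ fun _ => abs_nonneg _) ((hintφRabs.const_mul _).add ((hiabs.mul_const _).const_mul _)) (ae_of_all _ hrow)
      _ = κ * c * (∫ u, |φ u| * Rabs u ∂configMeasure SU2 1) + τ * m ^ 2 := by
          rw [integral_add (hintφRabs.const_mul _) ((hiabs.mul_const _).const_mul _), integral_const_mul, integral_const_mul, integral_mul_const, hm, sq]
  have htop : qform su2Rep B (fun u => |φ u|) (fun u => |φ u|) ≤ levelValue su2Rep 1 B 0 * l2 φ φ :=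
    qform_abs_le_levelValue_zero_mul hB hφm hCφ hφg (by simpa using hδ) hsupp
  have hnn : 0 ≤ qform su2Rep B φ φ := qform_self_nonneg_of_bounded hB hφm hCφ
  have hm2 : m ^ 2 ≤ l2 φ φ := by rw [hm, l2_self_eq_integral_sq]; exact sq_integral_abs_le_integral_sq_of_bounded hφm hCφ
  have hκc : 0 ≤ κ * c := mul_nonneg hκ hc
  calc |tubeForm β (boFun L φ Ω) - c * qform su2Rep B φ φ| ≤ κ * c * qform su2Rep B (fun u => |φ u|) (fun u => |φ u|) + τ * m ^ 2 := habs
    _ ≤ κ * c * (levelValue su2Rep 1 B 0 * l2 φ φ) + τ * l2 φ φ := add_le_add (mul_le_mul_of_nonneg_left htop hκc) (mul_le_mul_of_nonneg_left hm2 hτ)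
    _ ≤ κ * c * (qform su2Rep B φ φ + levelValue su2Rep 1 B 0 * l2 φ φ) + τ * l2 φ φ := by nlinarith

/-! ## §3 ★★ The colour-localised version and the `∀ᶠ β` packaging -/

/-- ★★ **`|fpBOKernel − CK₁| ≤ κCK₁ + τ` on the window ⇒ `|𝒦 − (C/Z)K̃₁| ≤ κ(C/Z)K̃₁ + τ/Z` on the window.** [cite: Luscher1983, §3] -/
theorem boKernel_pointwise_of_fp_add (β B : ℝ) {Ω : LinkSpace L → ℝ} (hΩm : Measurable Ω) {CΩ : ℝ} (hCΩ : ∀ x, |Ω x| ≤ CΩ)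
    (hΩinv : ∀ (g : SU2) (x : LinkSpace L), Ω (adL L g x) = Ω x)
    {W : (Site 3 L → SU2) → ℝ} (hW : Measurable W) {CW : ℝ} (hCW : ∀ g, |W g| ≤ CW) {Z : ℝ} (hZ0 : 0 < Z)
    (hZ : ∀ g : Site 3 L → SU2, ∫ c, W (fun x => c * g x) ∂haarProbability SU2 = Z)
    {C κ τ δ : ℝ}
    (hpt : ∀ u u' : GaugeConfig 3 1 SU2, orbitDist u < δ → orbitDist u' < δ →
      |fpBOKernel L β Ω W u u' - C * transferKernel su2Rep B u u'| ≤ κ * C * transferKernel su2Rep B u u' + τ)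
    (u u' : GaugeConfig 3 1 SU2) (hu : orbitDist u < δ) (hu' : orbitDist u' < δ) :
    |boKernel L β Ω u u' - C / Z * avgKernel B u u'| ≤ κ * (C / Z) * avgKernel B u u' + τ / Z := by
  haveI : SecondCountableTopology SU2 := secondCountableTopology_su2
  obtain ⟨hint, hid⟩ := boKernel_fp (L := L) β hΩm hCΩ hΩinv hW hCW hZ u u'
  have hK1m : Measurable fun c : SU2 => transferKernel su2Rep B (gaugeTransform (fun _ : Site 3 1 => c⁻¹) u) u' := by
    have h1 : Measurable fun c : SU2 => gaugeTransform (fun _ : Site 3 1 => c⁻¹) u := by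
      have h := (measurable_constGaugeAction_left (L := 1) u).comp measurable_inv
      simpa only [Function.comp_def] using h
    have h2 : Measurable fun c : SU2 => (gaugeTransform (fun _ : Site 3 1 => c⁻¹) u, u') := h1.prodMk measurable_const
    have h := (continuous_transferKernel su2Rep continuous_su2Rep B (L := 1)).measurable.comp h2
    simpa only [Function.comp_def] using h
  obtain ⟨M1, hM1⟩ := exists_transferKernel_le su2Rep continuous_su2Rep B (L := 1)
  have hK1int : Integrable (fun c : SU2 => transferKernel su2Rep B (gaugeTransform (fun _ : Site 3 1 => c⁻¹) u) u') (haarProbability SU2) :=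
    integrable_of_measurable_abs_le _ hK1m (C := M1) fun c => by rw [abs_of_pos (transferKernel_pos su2Rep B _ _)]; exact hM1 _ _
  have hav := avgKernel_one_eq_integral_conj B u u'
  have hptc : ∀ c : SU2, |fpBOKernel L β Ω W (gaugeTransform (fun _ : Site 3 1 => c⁻¹) u) u' - C * transferKernel su2Rep B (gaugeTransform (fun _ : Site 3 1 => c⁻¹) u) u'| ≤
      κ * C * transferKernel su2Rep B (gaugeTransform (fun _ : Site 3 1 => c⁻¹) u) u' + τ := fun c =>
    hpt _ _ (by rw [orbitDist_gaugeTransform]; exact hu) hu'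
  have hdiff : boKernel L β Ω u u' - C / Z * avgKernel B u u' =
      Z⁻¹ * ∫ c, (fpBOKernel L β Ω W (gaugeTransform (fun _ : Site 3 1 => c⁻¹) u) u' - C * transferKernel su2Rep B (gaugeTransform (fun _ : Site 3 1 => c⁻¹) u) u')
        ∂haarProbability SU2 := by
    rw [integral_sub hint (hK1int.const_mul C), integral_const_mul, ← hid, ← hav]
    field_simp
  have hI : |∫ c, (fpBOKernel L β Ω W (gaugeTransform (fun _ : Site 3 1 => c⁻¹) u) u' - C * transferKernel su2Rep B (gaugeTransform (fun _ : Site 3 1 => c⁻¹) u) u')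
      ∂haarProbability SU2| ≤ κ * C * avgKernel B u u' + τ := by
    rw [hav]
    calc |∫ c, (fpBOKernel L β Ω W (gaugeTransform (fun _ : Site 3 1 => c⁻¹) u) u' - C * transferKernel su2Rep B (gaugeTransform (fun _ : Site 3 1 => c⁻¹) u) u') ∂haarProbability SU2|
        ≤ ∫ c, |fpBOKernel L β Ω W (gaugeTransform (fun _ : Site 3 1 => c⁻¹) u) u' - C * transferKernel su2Rep B (gaugeTransform (fun _ : Site 3 1 => c⁻¹) u) u'| ∂haarProbability SU2 :=
          abs_integral_le_integral_abs
      _ ≤ ∫ c, (κ * C * transferKernel su2Rep B (gaugeTransform (fun _ : Site 3 1 => c⁻¹) u) u' + τ) ∂haarProbability SU2 :=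
          integral_mono_of_nonneg (ae_of_all _ fun _ => abs_nonneg _) ((hK1int.const_mul _).add (integrable_const _)) (ae_of_all _ hptc)
      _ = κ * C * ∫ c, transferKernel su2Rep B (gaugeTransform (fun _ : Site 3 1 => c⁻¹) u) u' ∂haarProbability SU2 + τ := by
          rw [integral_add (hK1int.const_mul _) (integrable_const _), integral_const_mul]; simp
  rw [hdiff, abs_mul, abs_of_pos (inv_pos.mpr hZ0)]
  calc Z⁻¹ * |∫ c, (fpBOKernel L β Ω W (gaugeTransform (fun _ : Site 3 1 => c⁻¹) u) u' - C * transferKernel su2Rep B (gaugeTransform (fun _ : Site 3 1 => c⁻¹) u) u')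
        ∂haarProbability SU2| ≤ Z⁻¹ * (κ * C * avgKernel B u u' + τ) := mul_le_mul_of_nonneg_left hI (inv_pos.mpr hZ0).le
    _ = κ * (C / Z) * avgKernel B u u' + τ / Z := by field_simp

/-- ★★★ **(B-T) FROM THE COLOUR-LOCALISED RELATIVE-PLUS-ABSOLUTE COMPARISON** (the `∀ᶠ β` form of `RecordAnalyticInput.hT`, `σ β := C β/Z β/γ β`, rate `κ β + κ₂ β`): eventually
`|fpBOKernel − C·K₁^{(L³β)}| ≤ κ·C·K₁^{(L³β)} + τ` on the window, with the tail budget `τ β/Z β ≤ κ₂ β·(C β/Z β)·λ₀(1, L³β)`. [cite: Luscher1983, §3] -/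
theorem hT_of_fp_add {s : ℝ} (hs : 0 < s) {Ω : ℝ → LinkSpace L → ℝ} (hΩm : ∀ β, Measurable (Ω β)) (hΩ1 : ∀ β x, |Ω β x| ≤ 1)
    (hΩinv : ∀ β (g : SU2) (x : LinkSpace L), Ω β (adL L g x) = Ω β x) (hγ : ∀ β, 0 < recordGamma L Ω β)
    {W : ℝ → (Site 3 L → SU2) → ℝ} (hW : ∀ β, Measurable (W β)) {CW : ℝ → ℝ} (hCW : ∀ β g, |W β g| ≤ CW β) {Z : ℝ → ℝ} (hZ0 : ∀ β, 0 < Z β)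
    (hZ : ∀ β (g : Site 3 L → SU2), ∫ c, W β (fun x => c * g x) ∂haarProbability SU2 = Z β)
    {C κ κ₂ τ : ℝ → ℝ} (hC : ∀ β, 0 ≤ C β) (hκ : ∀ β, 0 ≤ κ β) (hκ₂ : ∀ β, 0 ≤ κ₂ β) (hτ : ∀ β, 0 ≤ τ β)
    (hτZ : ∀ᶠ β : ℝ in atTop, τ β / Z β ≤ κ₂ β * (C β / Z β) * levelValue su2Rep 1 ((L : ℝ) ^ 3 * β) 0)
    (hpt : ∀ᶠ β : ℝ in atTop, ∀ u u' : GaugeConfig 3 1 SU2, orbitDist u < recordDelta1 L s β → orbitDist u' < recordDelta1 L s β →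
      |fpBOKernel L β (Ω β) (W β) u u' - C β * transferKernel su2Rep ((L : ℝ) ^ 3 * β) u u'| ≤
        κ β * C β * transferKernel su2Rep ((L : ℝ) ^ 3 * β) u u' + τ β) :
    ∀ᶠ β : ℝ in atTop, ∀ φ : GaugeConfig 3 1 SU2 → ℝ, Measurable φ → (∃ C : ℝ, ∀ u, |φ u| ≤ C) →
      (∀ (g : Site 3 1 → SU2) (u : GaugeConfig 3 1 SU2), φ (gaugeTransform g u) = φ u) → (∀ u, φ u ≠ 0 → orbitDist u < recordDelta1 L s β) →
      |tubeForm β (boFun L φ (Ω β)) - (C β / Z β / recordGamma L Ω β) * recordGamma L Ω β * qform su2Rep ((L : ℝ) ^ 3 * β) φ φ| ≤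
        (κ β + κ₂ β) * ((C β / Z β / recordGamma L Ω β) * recordGamma L Ω β) *
          (qform su2Rep ((L : ℝ) ^ 3 * β) φ φ + levelValue su2Rep 1 ((L : ℝ) ^ 3 * β) 0 * l2 φ φ) := by
  have hδ := recordDelta1_le_half (L := L) hs
  filter_upwards [hpt, hδ, hτZ, eventually_ge_atTop (0 : ℝ)] with β hβ hδβ hτβ hβ0 φ hφm hφb hφg hsupp
  obtain ⟨Cφ, hCφ⟩ := hφb
  have hcγ : C β / Z β / recordGamma L Ω β * recordGamma L Ω β = C β / Z β := div_mul_cancel₀ _ (hγ β).ne'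
  rw [hcγ]
  have hB : 0 ≤ (L : ℝ) ^ 3 * β := by positivity
  have hpt' : ∀ u u' : GaugeConfig 3 1 SU2, orbitDist u < recordDelta1 L s β → orbitDist u' < recordDelta1 L s β →
      |boKernel L β (Ω β) u u' - C β / Z β * avgKernel ((L : ℝ) ^ 3 * β) u u'| ≤ κ β * (C β / Z β) * avgKernel ((L : ℝ) ^ 3 * β) u u' + τ β / Z β :=
    fun u u' hu hu' => boKernel_pointwise_of_fp_add β ((L : ℝ) ^ 3 * β) (hΩm β) (hΩ1 β) (hΩinv β) (hW β) (hCW β) (hZ0 β) (hZ β) hβ u u' hu hu'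
  have hmain := tubeForm_boFun_near_of_pointwise_add β hB (hΩm β) (hΩ1 β) (div_nonneg (hC β) (hZ0 β).le) (hκ β) (div_nonneg (hτ β) (hZ0 β).le)
    (by linarith) hpt' hφm hCφ hφg hsupp
  have hl2 : 0 ≤ l2 φ φ := by rw [l2_self_eq_integral_sq]; exact integral_nonneg fun u => sq_nonneg _
  have hq : 0 ≤ qform su2Rep ((L : ℝ) ^ 3 * β) φ φ := qform_self_nonneg_of_bounded hB hφm hCφ
  have hlv : 0 ≤ levelValue su2Rep 1 ((L : ℝ) ^ 3 * β) 0 := (levelValue_zero_su2Rep_pos 1 _).le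
  have htail : τ β / Z β * l2 φ φ ≤ κ₂ β * (C β / Z β) * (qform su2Rep ((L : ℝ) ^ 3 * β) φ φ + levelValue su2Rep 1 ((L : ℝ) ^ 3 * β) 0 * l2 φ φ) := by
    calc τ β / Z β * l2 φ φ ≤ κ₂ β * (C β / Z β) * levelValue su2Rep 1 ((L : ℝ) ^ 3 * β) 0 * l2 φ φ := mul_le_mul_of_nonneg_right hτβ hl2
      _ ≤ κ₂ β * (C β / Z β) * (qform su2Rep ((L : ℝ) ^ 3 * β) φ φ + levelValue su2Rep 1 ((L : ℝ) ^ 3 * β) 0 * l2 φ φ) := by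
          have h0 : 0 ≤ κ₂ β * (C β / Z β) := mul_nonneg (hκ₂ β) (div_nonneg (hC β) (hZ0 β).le)
          nlinarith
  calc |tubeForm β (boFun L φ (Ω β)) - C β / Z β * qform su2Rep ((L : ℝ) ^ 3 * β) φ φ|
      ≤ κ β * (C β / Z β) * (qform su2Rep ((L : ℝ) ^ 3 * β) φ φ + levelValue su2Rep 1 ((L : ℝ) ^ 3 * β) 0 * l2 φ φ) + τ β / Z β * l2 φ φ := hmain
    _ ≤ (κ β + κ₂ β) * (C β / Z β) * (qform su2Rep ((L : ℝ) ^ 3 * β) φ φ + levelValue su2Rep 1 ((L : ℝ) ^ 3 * β) 0 * l2 φ φ) := by nlinarith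

end Summit.QuantumFields.YangMills.Theorems.FemtoTransferGap.TwoLattice.ConstTube

end
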